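import Literature.NumberTheory.EllipticCurves.FormalGroupChartLimitLogAdditiveProofs
import Literature.NumberTheory.EllipticCurves.SingularCubicPointCountProofs
import HarnessLib

/-!
# Additive reduction: a logarithm vanishing (mod 𝔪) on a point of `E₀ ∖ E₁` cannot cover `𝒪` —
# the kernel form of the «hidden quadratic 3-torsion» obstruction (census kit j282799)

Cell `bsd-addord`, seat `bsd-addord-w2-acc3` (PROGRAMME PART 1b row (3), gen 8); `--supports
stmt-BirchSwinnertonDyer-19679` (helper). TOOL theorems only (no definition, no instance, no named fact, no
`sorry`); pure algebra of a Weierstrass equation over a valuation ring with CUSPIDAL reduction; closes nothing;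
nothing booked; BSD / 19679 / 19599 / 20398 are not proved by any of this.

WHY. The EXACT («`b = 0`») per-factor road of the additive rows (seat w2-c4 gen 10
`KimAtThreeShallowEqDeepDefectOfDefinedKato` ⟹ (C1₂) = item 20398; `…KatoStratumOfDefinedKato`) rests on
«`log_ω(E₀(K)) = 𝒪_K` at every unramified `K`». The census of this seat (kit j282799, HOME/w2acc3-g8/,
evidence #34 on 19679) finds `E(ℚ_9)[3] ≠ 0` — hence `E(L_w)[3] ≠ 0` at every tame cyclotomic level of EVEN residue
degree — on 66 261 of the 128 637 `t = 0` tower rows (all (M)@3 rows, all type-IV rows). THIS FILE is the algebra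
behind the consequence, in the generality of the tree's `FormalGroupChartLimitLogAdditiveProofs` (any valued field
`(L, w)`, `W₀` over `𝒪 = w.integer` with cuspidal reduction `Δ̃ = 0`, `c̃₄ = 0`, finite residue field `k`):

* ★★ `not_forall_exists_eq_of_not_reducesToZero` — for ANY additive `λ : E₀(L) →+ L` that is `𝔪`-small on
  `E₁(L)` (`w(λ P) < 1` whenever `P` reduces to `Õ` — every logarithm is: `log_ω E₁ ⊆ p𝒪`), **if some
  `T ∈ E₀(L) ∖ E₁(L)` has `w(λ T) < 1` (e.g. a TORSION point of `E₀` outside `E₁`: `λ T = 0`), then `λ(E₀(L))`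
  does NOT contain `𝒪`**: `¬ ∀ o, w o ≤ 1 → ∃ P, λ P = o`. Proof (pigeonhole, no group law on the cusp needed):
  on `S := λ⁻¹(𝒪)` the residue `μ = λ mod 𝔪 : S → k` factors through the reduction `S → E₀/E₁ ↪ Ẽ_ns(k)`
  (`reductionHom`, kernel `E₁` by `reductionHom_ker`); if `λ` covered `𝒪`, `μ` would be onto `k`, so the factor
  map `range → k` would be a surjection between sets of size `≤ #Ẽ_ns(k) = #k` (CUSP: `natCard_point_of_Δ_eq_zero`)
  and `#k`, hence injective — but `T` and `O` have the same `μ`-value `0` and different reductions.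
* `not_forall_exists_eq_of_torsion` — the torsion form: `T ∈ E₀(L)`, `T ∉ E₁(L)`, `n • T = 0` with `n ≠ 0` in `L`.

The consumer at `L = L_w = ℚ(ζ_m)_w` (`3 ∤ m`, `f` even, a row with `t = 0 < t′`): `T` = the hidden `3`-torsion point
(in `E₀` by the Pannekoek flag of the census), `T ∉ E₁` because `E₁(L_w)[3] = 0` (acc3 gen 7
`UnramifiedKernelTorsion`), `λ = log_ω` restricted to `E₀` — so `𝒪_w ⊄ log_ω E₀(L_w)` there.

References: J. H. Silverman, *AEC* (2009) VII.2 Prop. 2.1, III.2.5, Ex. 3.5 [SilvermanAEC2009];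
C.-H. Kim, *AJM* 148 (2026) §3.2.3, Lemma 3.9–3.10 [Kim2022StructureSelmer].
-/

set_option autoImplicit false
-- the cell's Theorems namespace `Summit.BirchSwinnertonDyer.BirchSwinnertonDyer.…` repeats the summit name by design (D-0017)
set_option linter.dupNamespace false

noncomputable section

open scoped Classical NNReal
open WeierstrassCurve Literature.NumberTheory.EllipticCurves

namespace Summit.BirchSwinnertonDyer.BirchSwinnertonDyer.Theorems.KimAtThreeAdditiveHiddenTorsionLattice

variable {L : Type*} [Field L] (w : Valuation L ℝ≥0) (W₀ : WeierstrassCurve w.integer)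

/-- ★★ **A logarithm that vanishes mod `𝔪` on a point of `E₀ ∖ E₁` cannot cover `𝒪` (additive reduction).**
`(L, w)` a valued field, `W₀` over `𝒪 = w.integer` with CUSPIDAL reduction (`Δ̃ = 0`, `c̃₄ = 0`), finite residue
field; `λ : E₀(L) →+ L` additive with `w(λ P) < 1` on `E₁(L)`; `T ∈ E₀(L) ∖ E₁(L)` with `w(λ T) < 1`. Then
`¬ ∀ o, w o ≤ 1 → ∃ P ∈ E₀(L), λ P = o`. [cite: SilvermanAEC2009, VII.2 Prop. 2.1 with III.2.5 and Exercise 3.5] -/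
theorem not_forall_exists_eq_of_not_reducesToZero [Finite (IsLocalRing.ResidueField w.integer)]
    (hΔ : IsLocalRing.residue w.integer W₀.Δ = 0) (hc₄ : IsLocalRing.residue w.integer W₀.c₄ = 0)
    (lam : W₀.nonsingularReductionSubgroup (Valuation.integer.integers w) →+ L)
    (hlam : ∀ P : W₀.nonsingularReductionSubgroup (Valuation.integer.integers w),
      W₀.ReducesToZero (P : (W₀.baseChange L).toAffine.Point) → w (lam P) < 1)
    (T : W₀.nonsingularReductionSubgroup (Valuation.integer.integers w))
    (hT : ¬ W₀.ReducesToZero (T : (W₀.baseChange L).toAffine.Point)) (hTlam : w (lam T) < 1) :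
    ¬ ∀ o : L, w o ≤ 1 → ∃ P : W₀.nonsingularReductionSubgroup (Valuation.integer.integers w), lam P = o := by
  intro hsurj
  have hv : w.Integers w.integer := Valuation.integer.integers w
  -- residues: `residue ⟨x, _⟩ = 0 ↔ w x < 1`
  have hres0 : ∀ (x : L) (hx : w x ≤ 1), IsLocalRing.residue w.integer ⟨x, hx⟩ = 0 ↔ w x < 1 := by
    intro x hx
    rw [← v_algebraMap_lt_one_iff hv ⟨x, hx⟩]
    exact Iff.rfl
  -- the reduction `f : E₀ → Ẽ_ns(k)`, kernel `E₁`
  let f : W₀.nonsingularReductionSubgroup (Valuation.integer.integers w) →+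
      (W₀.map (IsLocalRing.residue w.integer)).toAffine.Point := W₀.reductionHom hv
  have hker : ∀ P : W₀.nonsingularReductionSubgroup (Valuation.integer.integers w),
      f P = 0 ↔ W₀.ReducesToZero (P : (W₀.baseChange L).toAffine.Point) := by
    intro P
    have h : P ∈ (W₀.reductionHom hv).ker ↔
        P ∈ (kernelOfReduction W₀ hv).addSubgroupOf (W₀.nonsingularReductionSubgroup hv) := by
      rw [reductionHom_ker hv]
    rw [AddMonoidHom.mem_ker, AddSubgroup.mem_addSubgroupOf, mem_kernelOfReduction_iff] at h
    exact h
  -- `λ mod 𝔪` is constant on the fibres of `f` inside `S = λ⁻¹(𝒪)`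
  have hfib : ∀ P Q : W₀.nonsingularReductionSubgroup (Valuation.integer.integers w), f P = f Q →
      ∀ (hP : w (lam P) ≤ 1) (hQ : w (lam Q) ≤ 1),
        IsLocalRing.residue w.integer ⟨lam P, hP⟩ = IsLocalRing.residue w.integer ⟨lam Q, hQ⟩ := by
    intro P Q hPQ hP hQ
    have h0 : f (P - Q) = 0 := by rw [map_sub, hPQ, sub_self]
    have hlt : w (lam (P - Q)) < 1 := hlam _ ((hker (P - Q)).mp h0)
    have hPQ1 : w (lam P - lam Q) ≤ 1 := by rw [← map_sub]; exact le_of_lt hlt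
    have hz : IsLocalRing.residue w.integer ⟨lam P - lam Q, hPQ1⟩ = 0 := by
      rw [hres0]; rw [← map_sub]; exact hlt
    have hsub : (⟨lam P - lam Q, hPQ1⟩ : w.integer) = ⟨lam P, hP⟩ - ⟨lam Q, hQ⟩ := Subtype.ext rfl
    rw [hsub, map_sub, sub_eq_zero] at hz
    exact hz
  -- the factor map `g : A → k` on `A = f(S)`, onto `k`
  let A : Set ((W₀.map (IsLocalRing.residue w.integer)).toAffine.Point) :=
    f '' {P | w (lam P) ≤ 1}
  have hAsub : ∀ a : A, ∃ P : W₀.nonsingularReductionSubgroup (Valuation.integer.integers w),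
      ∃ hP : w (lam P) ≤ 1, f P = a := by
    rintro ⟨a, P, hP, rfl⟩; exact ⟨P, hP, rfl⟩
  let g : A → IsLocalRing.ResidueField w.integer := fun a =>
    IsLocalRing.residue w.integer ⟨lam (hAsub a).choose, (hAsub a).choose_spec.choose⟩
  have hg : ∀ (P : W₀.nonsingularReductionSubgroup (Valuation.integer.integers w)) (hP : w (lam P) ≤ 1),
      g ⟨f P, P, hP, rfl⟩ = IsLocalRing.residue w.integer ⟨lam P, hP⟩ := by
    intro P hP
    exact hfib _ _ (hAsub ⟨f P, P, hP, rfl⟩).choose_spec.choose_spec _ hP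
  have hgsurj : Function.Surjective g := by
    intro c
    obtain ⟨o, rfl⟩ := IsLocalRing.residue_surjective c
    obtain ⟨P, hP⟩ := hsurj (o : L) o.2
    have hP1 : w (lam P) ≤ 1 := by rw [hP]; exact o.2
    refine ⟨⟨f P, P, hP1, rfl⟩, ?_⟩
    rw [hg P hP1]
    congr 1
    exact Subtype.ext hP
  -- counting: `#k ≤ #A ≤ #Ẽ_ns(k) = #k`, so `g` is a bijection
  have hcusp : Nat.card ((W₀.map (IsLocalRing.residue w.integer)).toAffine.Point) =
      Nat.card (IsLocalRing.ResidueField w.integer) := by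
    have hΔ' : (W₀.map (IsLocalRing.residue w.integer)).Δ = 0 := by rw [map_Δ, hΔ]
    have hc₄' : (W₀.map (IsLocalRing.residue w.integer)).c₄ = 0 := by rw [map_c₄, hc₄]
    exact ((W₀.map (IsLocalRing.residue w.integer)).natCard_point_of_Δ_eq_zero hΔ').2.2 hc₄'
  have hkpos : 0 < Nat.card (IsLocalRing.ResidueField w.integer) := Nat.card_pos
  haveI : Finite ((W₀.map (IsLocalRing.residue w.integer)).toAffine.Point) :=
    Nat.finite_of_card_ne_zero (by rw [hcusp]; exact hkpos.ne')
  haveI : Finite A := Finite.Set.subset Set.univ (Set.subset_univ _)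
  have hcardA : Nat.card A ≤ Nat.card (IsLocalRing.ResidueField w.integer) := by
    rw [← hcusp]
    exact Nat.card_le_card_of_injective (fun a : A => (a : (W₀.map (IsLocalRing.residue w.integer)).toAffine.Point))
      Subtype.val_injective
  have hcardk : Nat.card (IsLocalRing.ResidueField w.integer) ≤ Nat.card A :=
    Nat.card_le_card_of_surjective g hgsurj
  have hbij : Function.Bijective g := by
    rw [Nat.bijective_iff_surjective_and_card]
    exact ⟨hgsurj, le_antisymm hcardA hcardk⟩
  -- but `T` and `O` have the same `g`-value `0` and different reductions
  have hT1 : w (lam T) ≤ 1 := le_of_lt hTlam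
  have h00 : w (lam 0) ≤ 1 := by rw [map_zero, map_zero]; exact zero_le_one
  have hgT : g ⟨f T, T, hT1, rfl⟩ = 0 := by rw [hg T hT1, hres0]; exact hTlam
  have hg0 : g ⟨f 0, 0, h00, rfl⟩ = 0 := by
    rw [hg 0 h00, hres0, map_zero, map_zero]; exact zero_lt_one
  have heq : (⟨f T, T, hT1, rfl⟩ : A) = ⟨f 0, 0, h00, rfl⟩ := hbij.1 (hgT.trans hg0.symm)
  have hfT : f T = 0 := by
    have h : f T = f 0 := congrArg Subtype.val heq
    rwa [map_zero] at h
  exact hT ((hker T).mp hfT)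

/-- **Torsion form**: a TORSION point of `E₀(L)` outside `E₁(L)` (order `n` with `n ≠ 0` in `L`) obstructs
`𝒪 ⊆ λ(E₀(L))` for every additive `λ` that is `𝔪`-small on `E₁(L)` — at an unramified `L_w ∣ 3` of even residue
degree on a `t = 0 < t′` row, `T` is the hidden `3`-torsion point (`T ∉ E₁` as `E₁(L_w)[3] = 0`) and `λ = log_ω`.
[cite: SilvermanAEC2009, VII.2 Prop. 2.1 with III.2.5 and Exercise 3.5] [cite: Kim2022StructureSelmer, §3.2.3, Lemma 3.9–3.10] -/
theorem not_forall_exists_eq_of_torsion [Finite (IsLocalRing.ResidueField w.integer)]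
    (hΔ : IsLocalRing.residue w.integer W₀.Δ = 0) (hc₄ : IsLocalRing.residue w.integer W₀.c₄ = 0)
    (lam : W₀.nonsingularReductionSubgroup (Valuation.integer.integers w) →+ L)
    (hlam : ∀ P : W₀.nonsingularReductionSubgroup (Valuation.integer.integers w),
      W₀.ReducesToZero (P : (W₀.baseChange L).toAffine.Point) → w (lam P) < 1)
    (T : W₀.nonsingularReductionSubgroup (Valuation.integer.integers w))
    (hT : ¬ W₀.ReducesToZero (T : (W₀.baseChange L).toAffine.Point))
    {n : ℕ} (hn : (n : L) ≠ 0) (hnT : n • T = 0) :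
    ¬ ∀ o : L, w o ≤ 1 → ∃ P : W₀.nonsingularReductionSubgroup (Valuation.integer.integers w), lam P = o := by
  refine not_forall_exists_eq_of_not_reducesToZero w W₀ hΔ hc₄ lam hlam T hT ?_
  have h : (n : L) * lam T = 0 := by rw [← nsmul_eq_mul, ← map_nsmul, hnT, map_zero]
  have hT0 : lam T = 0 := (mul_eq_zero.mp h).resolve_left hn
  rw [hT0, map_zero]
  exact zero_lt_one

end Summit.BirchSwinnertonDyer.BirchSwinnertonDyer.Theorems.KimAtThreeAdditiveHiddenTorsionLattice

end
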